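import Literature.Probability.RandomPlanarGeometry.LSW2004KeyEstimateComputation
import Literature.Analysis.Complex.HalfPlaneTwoArcHarmonic
import HarnessLib

/-!
# [LSW04] Prop. 4.2/4.3: the explicit `h` is `1 - ω(√z)`, `ω` the harmonic measure of `[-1,1]`

G. F. Lawler, O. Schramm, W. Werner, Ann. Probab. **32** (2004), proof of Prop. 4.3 (arXiv
math/0112234, p. 22): "`h(z) := (1/π) cot⁻¹((1 - |z|)/(2 Im √z))` … (Of course, we found the map
`h` satisfying these boundary conditions by reflecting the domain along the negative real axis,
mapping this larger domain to `ℍ` with `z ↦ √z`, and then using a conformal map from `ℍ` to `𝕌` to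
calculate the hitting probabilities.)" The tree has LSW's `h` as `USTPeano.KeyEstimate.keyH`
(`LSW2004KeyEstimateComputation.lean`, with `keyH = 1 + Im G`, `G = -(1/π) Log((√z-1)/(√z+1))`) and
the harmonic measure `ω = Literature.Analysis.Complex.hmSeg` of `[-1, 1]` in `ℍ`
(`HalfPlaneTwoArcHarmonic.lean`, whose `eq_one_sub_hmSeg` / `ThreeArc.eq_one_sub_hmSeg_sq`
identify bounded solutions of the three-arc mixed problem). This file records the link
**`keyH z = 1 - ω(√z)`** on `ℍ` (`keyH_eq_one_sub_hmSeg_csqrt`), so that a scaling limit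
identified as `1 - ω(√·)` is LSW's `h`. Everything is proved.
-/

noncomputable section

open Complex Literature.Analysis.Complex

namespace Literature.Probability.RandomPlanarGeometry

namespace USTPeano

namespace KeyEstimate

/-- For `s` in the upper half-plane, `arg((s - 1)/(s + 1)) = arg(s - 1) - arg(s + 1)` (both
arguments lie in `(0, π)`). [folklore] -/
theorem arg_keyMoebius {s : ℂ} (hs : 0 < s.im) :
    arg ((s - 1) / (s + 1)) = arg (s - 1) - arg (s + 1) := by
  have him1 : 0 < (s - 1).im := by simpa using hs
  have him2 : 0 < (s + 1).im := by simpa using hs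
  have hne1 : s - 1 ≠ 0 := fun h ↦ by rw [h] at him1; simp at him1
  have hne2 : s + 1 ≠ 0 := fun h ↦ by rw [h] at him2; simp at him2
  have hpos : ∀ {w : ℂ}, 0 < w.im → 0 < arg w ∧ arg w < Real.pi := fun {w} hw ↦ by
    refine ⟨lt_of_le_of_ne (arg_nonneg_iff.2 hw.le) fun h ↦ ?_, arg_lt_pi_iff.2 (Or.inr hw.ne')⟩
    have := arg_eq_zero_iff.1 h.symm
    exact hw.ne' this.2
  have h1 := hpos him1
  have h2 := hpos him2
  have hmem : arg (s - 1) - arg (s + 1) ∈ Set.Ioc (-Real.pi) Real.pi := by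
    constructor <;> linarith
  have h := arg_div_coe_angle hne1 hne2
  rw [← Real.Angle.coe_sub, arg_coe_angle_eq_iff_eq_toReal,
    Real.Angle.toReal_coe_eq_self_iff_mem_Ioc.2 hmem] at h
  exact h

/-- **LSW's `h` is `1 - ω(√z)` on `ℍ`**, `ω = hmSeg` the harmonic measure of `[-1, 1]` in `ℍ` and
`√` the principal branch (`csqrt`). [cite: LawlerSchrammWerner2004, Prop. 4.3 (proof)] -/
theorem keyH_eq_one_sub_hmSeg_csqrt {z : ℂ} (hz : 0 < z.im) :
    keyH z = 1 - hmSeg (csqrt z) := by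
  rw [keyH_eq hz, keyG_im, keyQ, arg_keyMoebius (csqrt_im_pos hz), hmSeg]
  ring

end KeyEstimate

end USTPeano

end Literature.Probability.RandomPlanarGeometry
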